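import Summits.QuantumFields.YangMills.Theorems.Instrument.TorusFreePolymerZeros
import HarnessLib

/-!
# Instrument cell `ym-instrument`, crew (b): NO torus (G1) polymer with three plaquettes — `freePolymerCountT L f 3 = 0` for every even torus `L ≥ 4` (the cube-corner parity
# obstruction of RADIUS-DERIVATION (7.2), ported from `FreePolymerThreeZero` to `ZMod L`) — census zero lifting the torus (G1) engine to vanishing order `n₀ = 4`

QUESTIONS.md: Q-B2 (S2-SPEC v0.5.1 §0 reading (β-torus), `L = 2S₀ ≥ 10`; RADIUS-DERIVATION v0.6.2 (7.0)–(7.2)); cell `run/shared/lean/pub/ym-instrument/`, HUMAN RULING D-0084 (2),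
director-ym R138.  HONEST FRAMING (page 1, binding).  WHAT IS CERTIFIED HERE AND AT WHICH `(G, D, L, β)`: PURE COMBINATORICS of the periodic lattice `(ℤ/L)⁴`, `L ≥ 3` even (so
`L ≥ 4`), in the `b = 2` comb gauge (`TorusPolymerKraft.IsAxisLinkT ∕ IsFreeLinkT`): (§1) no torus plaquette contains `(w, j)` and `(w + e_j, j)`; a plaquette one of whose two
`a`-links is axis has even transverse coordinates; (§2) in an admissible 3-set every member has exactly one free link per direction; (§3) ★ `freePolymerCountT L f 3 = 0`
(`freePolymerCountT_three`), hence `= 0` for all `n ≤ 3` with `TorusPlaquetteGeometry.freePolymerCountT_eq_zero_of_le_two`; (§4 = separate file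
`TorusKPCriterionFreeN4`) the torus (G1) criterion `KPCriterionFreeSU2T L` at vanishing order `n₀ = 4`: radius `139/5000`, for every even `L ≥ 4` — the (β-torus) reading's typed
(G1) window then EQUALS the `ℤ⁴` one.  The census identity with `ℤ⁴` (Lemma W) is NOT typed here.  NOT a statement about
any gauge theory beyond the criterion object; NOT summit-bearing.  Grade (T).
-/

noncomputable section

open Finset
open Literature.MathematicalPhysics.QuantumFieldTheory.Balaban1983to89.StrongCouplingKPWindow (activitySupSU2)
open Summit.QuantumFields.YangMills.Theorems.Instrument.AbstractPolymerKraft (IncidenceSystem links atLink IsAdmConnected AdmClosed)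
open Summit.QuantumFields.YangMills.Theorems.Instrument.TorusPolymerKraft
  (TSite TEdge TPlaquette tEdges torusSystem IsAxisLinkT IsFreeLinkT freePolymerCountT)
open Summit.QuantumFields.YangMills.Theorems.Instrument.KPCriterionSU2RateRows (actCheck_sound expCheck_sound)
open Summit.QuantumFields.YangMills.Theorems.Instrument.KPCriterionSU2UnconditionalT2 (t2MajSum)
open Summit.QuantumFields.YangMills.Theorems.Instrument.TorusKPCriterionFree (KPCriterionFreeSU2T FreeCountsVanishBelowT kpCriterionFreeSU2T_of_t2)
open Literature.MathematicalPhysics.QuantumLattice (zmod_one_ne_zero_of_two_le)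
open Summit.QuantumFields.YangMills.Theorems.Instrument.TorusPlaquetteGeometry
  (single_index_injective_T add_single_ne_self_T add_single_add_single_ne_T mk_mem_tEdges_iff eq_of_mem_tEdges_of_ne
    even_val_add_one_iff not_isAxisLinkT_both)
open Summit.QuantumFields.YangMills.Theorems.Instrument.TorusFreePolymerZeros (freePolymerCountT_eq_zero_of_le_two)

namespace Summit.QuantumFields.YangMills.Theorems.Instrument.TorusFreePolymerThreeZero

variable {L : ℕ}

/-! ## §1 Two parallel links one step apart in their own direction; parity of a plaquette with an axis link -/

/-- No plaquette of `ℤ^d` contains both `(w, j)` and `(w + e_j, j)` (its two `j`-links differ by a unit vector in its OTHER direction). [folklore] -/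
theorem not_mem_parallel_shift (hL : 3 ≤ L) (r : TPlaquette L) (w : TSite L) (j : Fin 4) :
    ¬ (((w, j) : TEdge L) ∈ tEdges r ∧ ((w + Pi.single j 1, j) : TEdge L) ∈ tEdges r) := by
  rintro ⟨h1, h2⟩
  obtain ⟨y, ⟨⟨a, b⟩, hab⟩⟩ := r
  have hab' : a ≠ b := ne_of_lt hab
  rw [mk_mem_tEdges_iff] at h1 h2
  dsimp only at h1 h2
  -- in either direction case the two base points lie in `{y, y + e_c}` with `c ≠ j`, but differ by `e_j`
  have key : ∀ c : Fin 4, c ≠ j → (w = y ∨ w = y + Pi.single c 1) → (w + Pi.single j 1 = y ∨ w + Pi.single j 1 = y + Pi.single c 1) → False := by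
    intro c hcj hw hw'
    rcases hw with rfl | rfl <;> rcases hw' with h | h
    · exact add_single_ne_self_T (by omega) _ j h
    · exact hcj (single_index_injective_T (by omega) (add_left_cancel h)).symm
    · exact add_single_add_single_ne_T hL _ c j h
    · rw [add_assoc, add_comm (Pi.single c 1), ← add_assoc] at h
      exact add_single_ne_self_T (by omega) _ j (add_right_cancel h)
  rcases h1 with ⟨rfl, hw⟩ | ⟨rfl, hw⟩ <;> rcases h2 with ⟨h, hw'⟩ | ⟨h, hw'⟩
  · exact key b (fun hb => hab' hb.symm) hw hw'
  · exact hab' h.symm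
  · exact hab' h
  · exact key a hab' hw.symm hw'.symm

/-- If one of the two `a`-links `(y, a)`, `(y + e_b, a)` of the plaquette `(y; a, b)` (or `(y; b, a)`) is an axis link, then every coordinate of `y` transverse to `{a, b}` is even.
[folklore] -/
theorem even_of_axis_pair {y : TSite L} {a b : Fin 4} (h : IsAxisLinkT ((y, a) : TEdge L) ∨ IsAxisLinkT ((y + Pi.single b 1, a) : TEdge L)) {ν : Fin 4} (hνa : ν ≠ a)
    (hνb : ν ≠ b) : Even (y ν).val := by
  rcases h with h | h
  · exact h ν hνa
  · have := h ν hνa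
    dsimp only at this
    rwa [Pi.add_apply, Pi.single_eq_of_ne hνb, add_zero] at this

/-! ## §2 In an admissible triple every member has exactly one free link per direction -/

/-- In a plaquette set `X` closed on its free links, every free link of a member `p` lies in a second member. [folklore] -/
theorem exists_host [NeZero L] {X : Finset (TPlaquette L)} (hcl : AdmClosed (torusSystem L) IsFreeLinkT X) {p : TPlaquette L} (hp : p ∈ X) {g : TEdge L} (hg : g ∈ tEdges p)
    (hfree : IsFreeLinkT g) : ∃ q ∈ X, q ≠ p ∧ g ∈ tEdges q := by
  have two : 2 ≤ (atLink (torusSystem L) X g).card := hcl g (mem_biUnion.2 ⟨p, hp, hg⟩) hfree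
  obtain ⟨q, hq, hqp⟩ := Finset.exists_mem_ne (lt_of_lt_of_le one_lt_two two) p
  exact ⟨q, (mem_filter.1 hq).1, hqp, (mem_filter.1 hq).2⟩

/-- ★ In a THREE-element plaquette set closed on its free links, a member `p` cannot have three distinct free links (each would need its own host among the two other
members, and a host of two of them would equal `p`).  Stated for the two parallel `a`-links plus one more link. [folklore] -/
theorem not_three_free [NeZero L] (hL : 3 ≤ L) {X : Finset (TPlaquette L)} (h3 : X.card = 3) (hcl : AdmClosed (torusSystem L) IsFreeLinkT X) {p : TPlaquette L} (hp : p ∈ X) {g₁ g₂ g₃ : TEdge L}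
    (h₁ : g₁ ∈ tEdges p) (h₂ : g₂ ∈ tEdges p) (h₃ : g₃ ∈ tEdges p) (h12 : g₁ ≠ g₂) (h13 : g₁ ≠ g₃) (h23 : g₂ ≠ g₃)
    (f₁ : IsFreeLinkT g₁) (f₂ : IsFreeLinkT g₂) (f₃ : IsFreeLinkT g₃) : False := by
  classical
  obtain ⟨q₁, hq₁, hq₁p, hg₁⟩ := exists_host hcl hp h₁ f₁
  obtain ⟨q₂, hq₂, hq₂p, hg₂⟩ := exists_host hcl hp h₂ f₂
  obtain ⟨q₃, hq₃, hq₃p, hg₃⟩ := exists_host hcl hp h₃ f₃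
  -- the three hosts are pairwise distinct (a common host shares two links with `p`)
  have h12' : q₁ ≠ q₂ := fun h => hq₁p (eq_of_mem_tEdges_of_ne hL h12 hg₁ (h ▸ hg₂) h₁ h₂)
  have h13' : q₁ ≠ q₃ := fun h => hq₁p (eq_of_mem_tEdges_of_ne hL h13 hg₁ (h ▸ hg₃) h₁ h₃)
  have h23' : q₂ ≠ q₃ := fun h => hq₂p (eq_of_mem_tEdges_of_ne hL h23 hg₂ (h ▸ hg₃) h₂ h₃)
  -- so `p, q₁, q₂, q₃` are four distinct members of the 3-set `X`
  have hsub : ({p, q₁, q₂, q₃} : Finset (TPlaquette L)) ⊆ X := by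
    intro s hs; simp only [mem_insert, mem_singleton] at hs
    rcases hs with rfl | rfl | rfl | rfl <;> assumption
  have hcard : ({p, q₁, q₂, q₃} : Finset (TPlaquette L)).card = 4 := by
    rw [card_insert_of_notMem, card_insert_of_notMem, card_insert_of_notMem, card_singleton]
    · simpa using h23'
    · simp only [mem_insert, mem_singleton, not_or]; exact ⟨h12', h13'⟩
    · simp only [mem_insert, mem_singleton, not_or]; exact ⟨hq₁p.symm, hq₂p.symm, hq₃p.symm⟩
  have := card_le_card hsub
  omega

/-- ★ In a THREE-element plaquette set closed on its free links, for every member `(y; a, b)` one of the two `a`-links `(y, a)`, `(y + e_b, a)` is an axis link, and likewise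
one of the two `b`-links `(y, b)`, `(y + e_a, b)`. [folklore] -/
theorem axis_or_axis_of_three [NeZero L] (hL : 3 ≤ L) (hLe : Even L) {X : Finset (TPlaquette L)} (h3 : X.card = 3) (hcl : AdmClosed (torusSystem L) IsFreeLinkT X) {y : TSite L} {a b : Fin 4} {hab : a < b}
    (hp : ((y, ⟨(a, b), hab⟩) : TPlaquette L) ∈ X) :
    (IsAxisLinkT ((y, a) : TEdge L) ∨ IsAxisLinkT ((y + Pi.single b 1, a) : TEdge L)) ∧
      (IsAxisLinkT ((y, b) : TEdge L) ∨ IsAxisLinkT ((y + Pi.single a 1, b) : TEdge L)) := by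
  have hab' : a ≠ b := ne_of_lt hab
  have hm : ∀ e : TEdge L, e = (y, a) ∨ e = (y + Pi.single a 1, b) ∨ e = (y + Pi.single b 1, a) ∨ e = (y, b) →
      e ∈ tEdges ((y, ⟨(a, b), hab⟩) : TPlaquette L) := fun e he => by
    simp only [tEdges, mem_insert, mem_singleton]; exact he
  have m1 := hm (y, a) (Or.inl rfl)
  have m2 := hm (y + Pi.single a 1, b) (Or.inr (Or.inl rfl))
  have m3 := hm (y + Pi.single b 1, a) (Or.inr (Or.inr (Or.inl rfl)))
  have m4 := hm (y, b) (Or.inr (Or.inr (Or.inr rfl)))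
  -- distinctness of the four links
  have d13 : ((y, a) : TEdge L) ≠ (y + Pi.single b 1, a) := fun h => add_single_ne_self_T (by omega) y b (Prod.mk.inj h).1.symm
  have d14 : ((y, a) : TEdge L) ≠ (y, b) := fun h => hab' (Prod.mk.inj h).2
  have d12 : ((y, a) : TEdge L) ≠ (y + Pi.single a 1, b) := fun h => hab' (Prod.mk.inj h).2
  have d34 : ((y + Pi.single b 1, a) : TEdge L) ≠ (y, b) := fun h => hab' (Prod.mk.inj h).2
  have d32 : ((y + Pi.single b 1, a) : TEdge L) ≠ (y + Pi.single a 1, b) := fun h => hab' (Prod.mk.inj h).2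
  have d42 : ((y, b) : TEdge L) ≠ (y + Pi.single a 1, b) := fun h => add_single_ne_self_T (by omega) y a (Prod.mk.inj h).1.symm
  -- not both `a`-links axis, not both `b`-links axis (parity)
  have na := not_isAxisLinkT_both hLe y hab'
  have nb := not_isAxisLinkT_both hLe y (Ne.symm hab')
  constructor
  · by_contra h
    rw [not_or] at h
    -- both `a`-links free; one `b`-link is free too ⇒ three free links
    by_cases hb : IsAxisLinkT (y, b)
    · have f2 : IsFreeLinkT (y + Pi.single a 1, b) := fun h' => nb ⟨hb, h'⟩
      exact not_three_free hL h3 hcl hp m1 m3 m2 d13 d12 d32 h.1 h.2 f2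
    · exact not_three_free hL h3 hcl hp m1 m3 m4 d13 d14 d34 h.1 h.2 hb
  · by_contra h
    rw [not_or] at h
    by_cases ha : IsAxisLinkT (y, a)
    · have f3 : IsFreeLinkT (y + Pi.single b 1, a) := fun h' => na ⟨ha, h'⟩
      exact not_three_free hL h3 hcl hp m4 m2 m3 d42 d34.symm d32.symm h.1 h.2 f3
    · exact not_three_free hL h3 hcl hp m4 m2 m1 d42 d14.symm d12.symm h.1 h.2 ha

/-! ## §3 ★ No (G1) polymer with three plaquettes -/

/-- The free `a`-link of a plaquette `(y; a, b)` one of whose `a`-links is axis: it is `(y + ε e_b, a)` with `y_b + ε` odd; we record the form «there is `z ∈ {y, y + e_b}` with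
`(z, a)` free, in the plaquette, and `z_b` odd, `z_ν = y_ν` for `ν ≠ b`». [folklore] -/
theorem free_link_of_axis_pair [NeZero L] (hLe : Even L) {y : TSite L} {a b : Fin 4} (hab : a ≠ b)
    (h : IsAxisLinkT ((y, a) : TEdge L) ∨ IsAxisLinkT ((y + Pi.single b 1, a) : TEdge L)) :
    ∃ z : TSite L, (z = y ∨ z = y + Pi.single b 1) ∧ IsFreeLinkT ((z, a) : TEdge L) ∧ ¬ Even (z b).val := by
  have nb := not_isAxisLinkT_both hLe y hab
  rcases h with h | h
  · refine ⟨y + Pi.single b 1, Or.inr rfl, fun h' => nb ⟨h, h'⟩, ?_⟩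
    have he : Even (y b).val := h b (Ne.symm hab)
    rw [Pi.add_apply, Pi.single_eq_same, even_val_add_one_iff hLe]
    exact fun hn => hn he
  · refine ⟨y, Or.inl rfl, fun h' => nb ⟨h', h⟩, ?_⟩
    have he : Even ((y + Pi.single b 1 : TSite L) b).val := h b (Ne.symm hab)
    rw [Pi.add_apply, Pi.single_eq_same, even_val_add_one_iff hLe] at he
    exact he

/-- ★ **`freePolymerCountT L f 3 = 0` for every link `f`** (cube-corner parity obstruction). [folklore] -/
theorem freePolymerCountT_three [NeZero L] (hL : 3 ≤ L) (hLe : Even L) (f : TEdge L) : freePolymerCountT L f 3 = 0 := by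
  classical
  unfold freePolymerCountT
  haveI : IsEmpty {X : Finset (TPlaquette L) // X.card = 3 ∧ f ∈ links (torusSystem L) X ∧ IsAdmConnected (torusSystem L) IsFreeLinkT X ∧ AdmClosed (torusSystem L) IsFreeLinkT X} :=
    ⟨fun ⟨X, h3, hf, _, hcl⟩ => by
      -- a member `p = (x; i, j)`
      obtain ⟨p, hpX, -⟩ := mem_biUnion.1 hf
      obtain ⟨x, ⟨⟨i, j⟩, hij⟩⟩ := p
      have hij' : i ≠ j := ne_of_lt hij
      have hijN : (i : ℕ) < j := hij
      obtain ⟨hpi, hpj⟩ := axis_or_axis_of_three hL hLe h3 hcl hpX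
      -- transverse coordinates of `x` are even
      have hxe : ∀ ν : Fin 4, ν ≠ i → ν ≠ j → Even (x ν).val := fun ν hνi hνj => even_of_axis_pair hpi hνi hνj
      -- the free `i`-link `g₁ = (z, i)` of `p`, `z ∈ {x, x + e_j}`, `z_j` odd; and the free `j`-link `g₂ = (w, j)`, `w ∈ {x, x + e_i}`, `w_i` odd
      obtain ⟨z, hz, fz, hzodd⟩ := free_link_of_axis_pair hLe hij' hpi
      obtain ⟨w, hw, fw, hwodd⟩ := free_link_of_axis_pair hLe (Ne.symm hij') hpj
      have mz : ((z, i) : TEdge L) ∈ tEdges ((x, ⟨(i, j), hij⟩) : TPlaquette L) := by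
        simp only [tEdges, mem_insert, mem_singleton]
        rcases hz with rfl | rfl
        · exact Or.inl rfl
        · exact Or.inr (Or.inr (Or.inl rfl))
      have mw : ((w, j) : TEdge L) ∈ tEdges ((x, ⟨(i, j), hij⟩) : TPlaquette L) := by
        simp only [tEdges, mem_insert, mem_singleton]
        rcases hw with rfl | rfl
        · exact Or.inr (Or.inr (Or.inr rfl))
        · exact Or.inr (Or.inl rfl)
      -- hosts: `q ∋ (z, i)`, `r ∋ (w, j)`, both `≠ p`, and `q ≠ r`
      obtain ⟨q, hqX, hqp, hzq⟩ := exists_host hcl hpX mz fz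
      obtain ⟨r, hrX, hrp, hwr⟩ := exists_host hcl hpX mw fw
      have hzw : ((z, i) : TEdge L) ≠ (w, j) := fun h => hij' (Prod.mk.inj h).2
      have hqr : q ≠ r := fun h => hqp (eq_of_mem_tEdges_of_ne hL hzw hzq (h ▸ hwr) mz mw)
      -- STEP 1: `q` lies in the plane `{i, j}` with base `x ± e_j`: write `q = (y; a, b)` and use the parity of its transverse coordinates
      obtain ⟨y, ⟨⟨a, b⟩, hab⟩⟩ := q
      have habN : (a : ℕ) < b := hab
      obtain ⟨hqa, hqb⟩ := axis_or_axis_of_three hL hLe h3 hcl hqX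
      have hye : ∀ ν : Fin 4, ν ≠ a → ν ≠ b → Even (y ν).val := fun ν hνa hνb => even_of_axis_pair hqa hνa hνb
      have hzq' := hzq
      rw [mk_mem_tEdges_iff] at hzq'
      dsimp only at hzq'
      -- `z_j` is odd, `z` and `y` have the same `j`-coordinate unless the plane of `q` contains `j`; so `{a, b} = {i, j}`, i.e. `a = i`, `b = j`
      have hzj_y : a ≠ j → b ≠ j → False := fun haj hbj => by
        have hyj : Even (y j).val := hye j (Ne.symm haj) (Ne.symm hbj)
        rcases hzq' with ⟨-, rfl | rfl⟩ | ⟨-, rfl | rfl⟩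
        · exact hzodd hyj
        · rw [Pi.add_apply, Pi.single_eq_of_ne (Ne.symm hbj), add_zero] at hzodd; exact hzodd hyj
        · rw [Pi.add_apply, Pi.single_eq_of_ne (Ne.symm haj), add_zero] at hzodd; exact hzodd hyj
        · exact hzodd hyj
      have hab_ij : a = i ∧ b = j := by
        rcases hzq' with ⟨hai, _⟩ | ⟨hbi, _⟩
        · refine ⟨hai, ?_⟩
          by_contra hbj
          exact hzj_y (fun h => hij' (hai.symm.trans h)) hbj
        · exfalso
          -- `b = i` and `a < b = i < j` so `a ≠ j`, `b ≠ j`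
          exact hzj_y (fun h => by subst h; subst hbi; exact absurd (lt_trans habN hijN) (lt_irrefl _)) (fun h => hij' (hbi.symm.trans h))
      obtain ⟨hai, hbj⟩ := hab_ij
      have hia : i = a := hai.symm
      have hjb : j = b := hbj.symm
      subst hia; subst hjb
      -- now `q = (y; i, j)` and `(z, i) ∈ q`: `z = y` or `z = y + e_j`
      have hzy : z = y ∨ z = y + Pi.single j 1 := by
        rcases hzq' with ⟨-, h⟩ | ⟨hji, -⟩
        · exact h
        · exact absurd hji (Ne.symm hij')
      -- `y_i = x_i` (both `z = x + …e_j` and `z = y + …e_j`)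
      have hyx_i : y i = x i := by
        have h1 : z i = x i := by
          rcases hz with rfl | rfl
          · rfl
          · rw [Pi.add_apply, Pi.single_eq_of_ne hij', add_zero]
        have h2 : z i = y i := by
          rcases hzy with rfl | rfl
          · rfl
          · rw [Pi.add_apply, Pi.single_eq_of_ne hij', add_zero]
        exact h2.symm.trans h1
      -- STEP 2: the free `j`-link of `q` is `(w', j)` with `w' ∈ {y, y + e_i}`, `w'_i` odd; since `y_i = x_i`, `w' = w + (y - x)` i.e. `w'` differs from `w` by `± e_j`
      obtain ⟨w', hw', fw', hw'odd⟩ := free_link_of_axis_pair hLe (Ne.symm hij') hqb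
      have mw' : ((w', j) : TEdge L) ∈ tEdges ((y, ⟨(i, j), hab⟩) : TPlaquette L) := by
        simp only [tEdges, mem_insert, mem_singleton]
        rcases hw' with rfl | rfl
        · exact Or.inr (Or.inr (Or.inr rfl))
        · exact Or.inr (Or.inl rfl)
      -- the offsets `w - x` and `w' - y` agree (both `ε e_i` with the parity of `x_i = y_i` deciding `ε`)
      have hoff : (w = x ∧ w' = y) ∨ (w = x + Pi.single i 1 ∧ w' = y + Pi.single i 1) := by
        rcases hw with rfl | rfl <;> rcases hw' with rfl | rfl
        · exact Or.inl ⟨rfl, rfl⟩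
        · exfalso; rw [Pi.add_apply, Pi.single_eq_same, hyx_i, even_val_add_one_iff hLe] at hw'odd
          exact hw'odd hwodd
        · exfalso; rw [Pi.add_apply, Pi.single_eq_same, ← hyx_i, even_val_add_one_iff hLe] at hwodd
          exact hwodd hw'odd
        · exact Or.inr ⟨rfl, rfl⟩
      -- `y = x ± e_j` with `y ≠ x` (else `q = p`)
      have hyx : y ≠ x := by
        rintro rfl; exact hqp rfl
      have hshift : y = x + Pi.single j 1 ∨ x = y + Pi.single j 1 := by
        rcases hz with rfl | rfl <;> rcases hzy with h | h
        · exact absurd h.symm hyx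
        · exact Or.inr h
        · exact Or.inl h.symm
        · exact absurd (add_right_cancel h).symm hyx
      -- STEP 3: `(w', j)` lies in a second member; not in `p` (its `j`-coordinate differs from `x_j`), so in `r`, together with `(w, j)`: two parallel `j`-links one step apart
      obtain ⟨s, hsX, hsq, hw's⟩ := exists_host hcl hqX mw' fw'
      -- `(w', j) ∉ p`
      have hw'p : ((w', j) : TEdge L) ∉ tEdges ((x, ⟨(i, j), hij⟩) : TPlaquette L) := by
        intro hm
        rw [mk_mem_tEdges_iff] at hm
        dsimp only at hm
        rcases hm with ⟨hji, -⟩ | ⟨-, hm⟩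
        · exact hij' hji
        · -- `w' = x + e_i` or `w' = x`; but `w'_j = y_j = x_j ± 1`
          have hw'j : w' j = y j := by
            rcases hw' with rfl | rfl
            · rfl
            · rw [Pi.add_apply, Pi.single_eq_of_ne (Ne.symm hij'), add_zero]
          have hxj : w' j = x j := by
            rcases hm with rfl | rfl
            · rw [Pi.add_apply, Pi.single_eq_of_ne (Ne.symm hij'), add_zero]
            · rfl
          rcases hshift with h | h
          · have := congrFun h j; rw [Pi.add_apply, Pi.single_eq_same] at this
            exact zmod_one_ne_zero_of_two_le (L := L) (by omega) (add_eq_left.1 (this.symm.trans (hw'j.symm.trans hxj)))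
          · have := congrFun h j; rw [Pi.add_apply, Pi.single_eq_same] at this
            exact zmod_one_ne_zero_of_two_le (L := L) (by omega) (add_eq_left.1 (this.symm.trans (hxj.symm.trans hw'j)))
      -- hence `s = r`: `s ∈ X = {p, q, r}`, `s ≠ q`, `s ≠ p`
      have hsp : s ≠ ((x, ⟨(i, j), hij⟩) : TPlaquette L) := fun h => hw'p (h ▸ hw's)
      have hsr : s = r := by
        by_contra hsr
        have hsub : ({((x, ⟨(i, j), hij⟩) : TPlaquette L), ((y, ⟨(i, j), hab⟩) : TPlaquette L), r, s} : Finset (TPlaquette L)) ⊆ X := by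
          intro t ht; simp only [mem_insert, mem_singleton] at ht
          rcases ht with rfl | rfl | rfl | rfl <;> assumption
        have hcard : ({((x, ⟨(i, j), hij⟩) : TPlaquette L), ((y, ⟨(i, j), hab⟩) : TPlaquette L), r, s} : Finset (TPlaquette L)).card = 4 := by
          rw [card_insert_of_notMem, card_insert_of_notMem, card_insert_of_notMem, card_singleton]
          · simpa using (Ne.symm hsr)
          · simp only [mem_insert, mem_singleton, not_or]; exact ⟨hqr, hsq.symm⟩
          · simp only [mem_insert, mem_singleton, not_or]; exact ⟨hqp.symm, hrp.symm, hsp.symm⟩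
        have := card_le_card hsub
        omega
      subst hsr
      -- two parallel `j`-links of `s = r` one step apart in direction `j`
      rcases hoff with ⟨hw1, hw'1⟩ | ⟨hw1, hw'1⟩
      · rw [hw1] at hwr; rw [hw'1] at hw's
        rcases hshift with h | h
        · exact not_mem_parallel_shift hL s x j ⟨hwr, by rw [← h]; exact hw's⟩
        · exact not_mem_parallel_shift hL s y j ⟨hw's, by rw [← h]; exact hwr⟩
      · rw [hw1] at hwr; rw [hw'1] at hw's
        rcases hshift with h | h
        · refine not_mem_parallel_shift hL s (x + Pi.single i 1) j ⟨hwr, ?_⟩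
          rw [add_assoc, add_comm (Pi.single i 1), ← add_assoc, ← h]; exact hw's
        · refine not_mem_parallel_shift hL s (y + Pi.single i 1) j ⟨hw's, ?_⟩
          rw [add_assoc, add_comm (Pi.single i 1), ← add_assoc, ← h]; exact hwr⟩
  exact Nat.card_of_isEmpty

/-- ★ `freePolymerCountT L f n = 0` for every `n ≤ 3` and every link `f`. [folklore] -/
theorem freePolymerCountT_eq_zero_of_le_three [NeZero L] (hL : 3 ≤ L) (hLe : Even L) (f : TEdge L) {n : ℕ} (hn : n ≤ 3) : freePolymerCountT L f n = 0 := by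
  rcases Nat.lt_or_ge n 3 with h | h
  · exact freePolymerCountT_eq_zero_of_le_two hL hLe f (by omega)
  · have : n = 3 := by omega
    subst this
    exact freePolymerCountT_three hL hLe f

/-- `freePolymerCountT L f n = 0` for `n < 4`, every torus link `f`, every even `L ≥ 4`. [folklore] -/
theorem freeCountsVanishBelowT_four [NeZero L] (hL : 3 ≤ L) (hLe : Even L) : FreeCountsVanishBelowT L 4 :=
  fun f _ n hn => freePolymerCountT_eq_zero_of_le_three hL hLe f (by omega)

end Summit.QuantumFields.YangMills.Theorems.Instrument.TorusFreePolymerThreeZero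

end
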